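import Mathlib
import HarnessLib
import Literature.MathematicalPhysics.KineticTheory.VelocityFlipNoise
import Summits.AtomisticToContinuum.FouriersLaw.Theorems.VanishingNoiseTransferNoisyFourierFlipCeilingField

/-!
# Pair radiation of the flip forward field is `O(ε × local flip mass)` (stub S3 `stub_forwardFieldPairRadiation`)

`--supports stmt-AtomisticToContinuum-11976` file (crux `VanishingNoiseBound`, route `VanishingNoiseTransfer`, line
`line-energy_dipole_leak_coercivity`, registered stub `stub_forwardFieldPairRadiation`). Setting: the pinned chain
`P = pinnedChain ω₂ lam β γ` (all parameters `> 0`), `T > 0`, `L ≥ 2`, any flip rate `ε`, the Gibbs state `μ_T`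
(invariant under every velocity flip `F_z`), a classical forward field `g ∈ C²`, `|g| ≤ C₀e^{H/4T}`,
`(L_{T,T} + εS) g = −(p_0² − T)`; interior sites `x, y` (`x = y` allowed) and a smooth TWO-SITE observable `φ`
(depending only on `q_x, p_x, q_y, p_y`, vanishing as soon as one of them is `≥ R` in absolute value) ODD in `p_x`
and in `p_y`. Claim: `(∫ g X_H φ dμ_T)² ≤ 2ε²(d_x + d_y)‖φ‖²`, `d_z = ‖g∘F_z − g‖²` (`stub_forwardFieldPairRadiation`).
Proof (Bernardin–Olla 2011 §2.1): `(g, (p_0² − T) + εSg)` is a forward pair of the plain equilibrium generator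
(`flip_forwardPair`) and `(φ, X_H φ)` a backward pair (`S_B φ = 0`: `φ` does not see `p_0, p_{L−1}`); the cutoff-free
cross Green identity `integral_cross_eq` gives `∫ g X_H φ = ∫ φ(p_0² − T) + ε∫ φ Sg`; the first term vanishes by
oddness and flip invariance, `∫ φ Sg = ∫ (Sφ) g` and `Sφ = cφ` POINTWISE with `c = −2|{x, y}|`; finally
`(∫ gφ)² ≤ ¼ d_z ‖φ‖²` for `z = x, y` (`sq_integral_mul_le_of_odd`). The regularity inputs `φ, X_H φ ∈ L²(μ_T)` come
from the boundedness of `φ` and of its first partials (two-site observables with bounded live support: compactness)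
and the linear energy bound `Σ_i |∂_{q_i}H| ≤ C(1 + H)`. References: Bernardin–Olla 2011 §2.1; folklore.
-/

noncomputable section

open MeasureTheory Filter Topology Finset
open scoped ContDiff
open Literature.MathematicalPhysics.KineticTheory.HeatConduction
open Summit.AtomisticToContinuum.FouriersLaw.Theorems.SuperadditiveResistance.DeviceLiouville
  (kin liouvilleOp bathOp kin_eq_sq pinnedChain_sq_le_two_mul_hamiltonian)
open Summit.AtomisticToContinuum.FouriersLaw.Theorems.SuperadditiveResistance.Kubo (continuous_source)
open Summit.AtomisticToContinuum.FouriersLaw.Cruxes.SuperadditiveResistance.FloatingProbeBypassLaplacian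
  (pinnedChain_memLp_two_snd_sq)
open Summit.AtomisticToContinuum.FouriersLaw.Cruxes.ConductanceLowerBound.ForecastSensitivity
  (integral_cross_eq memLp_two_of_abs_le_exp)
open Summit.AtomisticToContinuum.FouriersLaw.Cruxes.SuperadditiveResistance.InsertionToolbox
  (pinnedChain_memLp_two_of_abs_le)
open Summit.AtomisticToContinuum.FouriersLaw.Theorems.NoisyFourier.FlipCeiling (sq_integral_mul_le_of_odd)

namespace Summit.AtomisticToContinuum.FouriersLaw.Theorems.VanishingNoiseBound

/-! ## Two-site observables: boundedness, bounded partials, flip noise -/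

section TwoSite

variable {L : ℕ} {x y : Fin L} {φ : PhaseSpace L → ℝ}

/-- A continuous observable depending only on the coordinates of the sites `x, y` and vanishing as soon as one
of these four coordinates is `≥ R` in absolute value is bounded (continuity on the compact box
`[-|R|, |R|]^{2L}` after zeroing the dead coordinates). [folklore] -/
theorem pairRadiation_exists_bound (hφ : Continuous φ)
    (hdep : ∀ u v : PhaseSpace L,
      (∀ k : Fin L, (k = x ∨ k = y) → u.1 k = v.1 k ∧ u.2 k = v.2 k) → φ u = φ v)
    {R : ℝ} (hR : ∀ u : PhaseSpace L, (R ≤ |u.1 x| ∨ R ≤ |u.2 x| ∨ R ≤ |u.1 y| ∨ R ≤ |u.2 y|) → φ u = 0) :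
    ∃ M : ℝ, ∀ u, |φ u| ≤ M := by
  classical
  set K : Set (PhaseSpace L) :=
    (Set.univ.pi fun _ : Fin L => Set.Icc (-|R|) |R|) ×ˢ (Set.univ.pi fun _ : Fin L => Set.Icc (-|R|) |R|)
    with hK
  have hKc : IsCompact K :=
    (isCompact_univ_pi fun _ => isCompact_Icc).prod (isCompact_univ_pi fun _ => isCompact_Icc)
  obtain ⟨C, hC⟩ := hKc.exists_bound_of_continuousOn hφ.continuousOn
  refine ⟨max C 0, fun u => ?_⟩
  by_cases hfar : R ≤ |u.1 x| ∨ R ≤ |u.2 x| ∨ R ≤ |u.1 y| ∨ R ≤ |u.2 y|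
  · rw [hR u hfar, abs_zero]
    exact le_max_right _ _
  · push Not at hfar
    obtain ⟨h1, h2, h3, h4⟩ := hfar
    -- zero the dead coordinates: the live ones lie in the box
    have hbox : ∀ w : Fin L → ℝ, |w x| < R → |w y| < R → ∀ k : Fin L,
        -|R| ≤ (if k = x ∨ k = y then w k else 0) ∧ (if k = x ∨ k = y then w k else 0) ≤ |R| := by
      intro w hwx hwy k
      by_cases hk : k = x ∨ k = y
      · rw [if_pos hk]
        have : |w k| ≤ |R| := by
          rcases hk with rfl | rfl
          · exact hwx.le.trans (le_abs_self R)
          · exact hwy.le.trans (le_abs_self R)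
        exact abs_le.mp this
      · rw [if_neg hk]
        exact ⟨by simp, abs_nonneg R⟩
    have huv : φ u = φ ((fun k => if k = x ∨ k = y then u.1 k else 0),
        (fun k => if k = x ∨ k = y then u.2 k else 0)) :=
      hdep _ _ fun k hk => by simp only [if_pos hk, and_self]
    have hvK : ((fun k => if k = x ∨ k = y then u.1 k else 0),
        (fun k => if k = x ∨ k = y then u.2 k else 0)) ∈ K := by
      simp only [hK, Set.mem_prod, Set.mem_univ_pi, Set.mem_Icc]
      exact ⟨hbox u.1 h1 h3, hbox u.2 h2 h4⟩
    have h := hC _ hvK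
    rw [Real.norm_eq_abs, ← huv] at h
    exact h.trans (le_max_left _ _)

/-- If `φ` depends only on the coordinates of the sites `x, y`, then `∂_{p_i} φ = 0` for every other site `i`.
[folklore] -/
theorem pairRadiation_partialP_eq_zero
    (hdep : ∀ u v : PhaseSpace L,
      (∀ k : Fin L, (k = x ∨ k = y) → u.1 k = v.1 k ∧ u.2 k = v.2 k) → φ u = φ v)
    {i : Fin L} (hi : ¬(i = x ∨ i = y)) (u : PhaseSpace L) : partialP i φ u = 0 := by
  unfold partialP
  have h : (fun t => φ (u.1, Function.update u.2 i t)) = fun _ => φ u := by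
    funext t
    refine hdep _ _ fun k hk => ⟨rfl, ?_⟩
    show Function.update u.2 i t k = u.2 k
    rw [Function.update_of_ne]
    rintro rfl
    exact hi hk
  rw [h, deriv_const]

/-- **Bounded partials of a `C¹` two-site observable with bounded live support**: there is `M ≥ 0` with
`|∂_{q_i} φ|, |∂_{p_i} φ| ≤ M` for all sites `i`. The Fréchet derivative `Dφ` is again a (continuous) two-site
observable (`φ` is invariant under translations along the dead coordinates) and vanishes where a live coordinate
exceeds `R` (there `φ ≡ 0` nearby), so `pairRadiation_exists_bound` applies to every partial. [folklore] -/
theorem pairRadiation_exists_partial_bound (hφ : ContDiff ℝ 1 φ)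
    (hdep : ∀ u v : PhaseSpace L,
      (∀ k : Fin L, (k = x ∨ k = y) → u.1 k = v.1 k ∧ u.2 k = v.2 k) → φ u = φ v)
    {R : ℝ} (hR : ∀ u : PhaseSpace L, (R ≤ |u.1 x| ∨ R ≤ |u.2 x| ∨ R ≤ |u.1 y| ∨ R ≤ |u.2 y|) → φ u = 0) :
    ∃ M : ℝ, 0 ≤ M ∧ ∀ (i : Fin L) (u : PhaseSpace L), |partialQ i φ u| ≤ M ∧ |partialP i φ u| ≤ M := by
  have hd : Differentiable ℝ φ := hφ.differentiable one_ne_zero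
  -- `Dφ` is a two-site observable
  have hdepD : ∀ u v : PhaseSpace L,
      (∀ k : Fin L, (k = x ∨ k = y) → u.1 k = v.1 k ∧ u.2 k = v.2 k) → fderiv ℝ φ u = fderiv ℝ φ v := by
    intro u v huv
    have hshift : (fun w => φ (w + (v - u))) = φ := by
      funext w
      refine hdep _ _ fun k hk => ⟨?_, ?_⟩
      · show w.1 k + (v.1 k - u.1 k) = w.1 k
        rw [(huv k hk).1, sub_self, add_zero]
      · show w.2 k + (v.2 k - u.2 k) = w.2 k
        rw [(huv k hk).2, sub_self, add_zero]
    calc fderiv ℝ φ u = fderiv ℝ (fun w => φ (w + (v - u))) u := by rw [hshift]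
      _ = fderiv ℝ φ v := by rw [fderiv_comp_add_right, add_sub_cancel]
  -- `Dφ = 0` where a live coordinate is `≥ R + 1`
  have hfar : ∀ u : PhaseSpace L,
      (R + 1 ≤ |u.1 x| ∨ R + 1 ≤ |u.2 x| ∨ R + 1 ≤ |u.1 y| ∨ R + 1 ≤ |u.2 y|) → fderiv ℝ φ u = 0 := by
    intro u hu
    have key : ∀ f : PhaseSpace L → ℝ, Continuous f → R + 1 ≤ f u → (∀ v, R ≤ f v → φ v = 0) →
        φ =ᶠ[𝓝 u] fun _ => (0 : ℝ) := fun f hf hfu h0 =>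
      ((hf.tendsto u).eventually (eventually_gt_nhds (show R < f u by linarith))).mono fun v hv => h0 v hv.le
    have hc1 : ∀ k : Fin L, Continuous fun v : PhaseSpace L => |v.1 k| := fun k =>
      continuous_abs.comp ((continuous_apply k).comp continuous_fst)
    have hc2 : ∀ k : Fin L, Continuous fun v : PhaseSpace L => |v.2 k| := fun k =>
      continuous_abs.comp ((continuous_apply k).comp continuous_snd)
    have hev : φ =ᶠ[𝓝 u] fun _ => (0 : ℝ) := by
      rcases hu with h | h | h | h
      · exact key _ (hc1 x) h fun v hv => hR v (Or.inl hv)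
      · exact key _ (hc2 x) h fun v hv => hR v (Or.inr (Or.inl hv))
      · exact key _ (hc1 y) h fun v hv => hR v (Or.inr (Or.inr (Or.inl hv)))
      · exact key _ (hc2 y) h fun v hv => hR v (Or.inr (Or.inr (Or.inr hv)))
    rw [hev.fderiv_eq, fderiv_const_apply]
  -- every partial is a continuous two-site observable with bounded live support
  have hQ : ∀ i : Fin L, ∃ M : ℝ, ∀ u, |partialQ i φ u| ≤ M := fun i =>
    pairRadiation_exists_bound (x := x) (y := y) (continuous_partialQ hφ one_ne_zero i)
      (fun u v huv => by simp only [partialQ_eq_fderiv hd i, hdepD u v huv]) (R := R + 1)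
      fun u h => by simp [partialQ_eq_fderiv hd i, hfar u h]
  have hP : ∀ i : Fin L, ∃ M : ℝ, ∀ u, |partialP i φ u| ≤ M := fun i =>
    pairRadiation_exists_bound (x := x) (y := y) (continuous_partialP hφ one_ne_zero i)
      (fun u v huv => by simp only [partialP_eq_fderiv hd i, hdepD u v huv]) (R := R + 1)
      fun u h => by simp [partialP_eq_fderiv hd i, hfar u h]
  choose Mq hMq using hQ
  choose Mp hMp using hP
  have hle : ∀ i : Fin L, |Mq i| + |Mp i| ≤ ∑ j, (|Mq j| + |Mp j|) := fun i =>
    Finset.single_le_sum (f := fun j => |Mq j| + |Mp j|) (fun j _ => by positivity) (Finset.mem_univ i)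
  refine ⟨∑ j, (|Mq j| + |Mp j|), Finset.sum_nonneg fun j _ => by positivity, fun i u => ⟨?_, ?_⟩⟩
  · exact (hMq i u).trans ((le_abs_self _).trans ((le_add_of_nonneg_right (abs_nonneg _)).trans (hle i)))
  · exact (hMp i u).trans ((le_abs_self _).trans ((le_add_of_nonneg_left (abs_nonneg _)).trans (hle i)))

/-- **Flip noise of a two-site observable odd in both live momenta**: `Sφ = cφ` pointwise with `c = −2|{x, y}|`,
so `c² ≤ 16` (`φ∘F_z = φ` for `z ∉ {x, y}`, `φ∘F_x = φ∘F_y = −φ`). [folklore] -/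
theorem pairRadiation_flipNoise_eq
    (hdep : ∀ u v : PhaseSpace L,
      (∀ k : Fin L, (k = x ∨ k = y) → u.1 k = v.1 k ∧ u.2 k = v.2 k) → φ u = φ v)
    (hoddx : ∀ u, φ (momentumFlip x u) = -φ u) (hoddy : ∀ u, φ (momentumFlip y u) = -φ u) :
    ∃ c : ℝ, c ^ 2 ≤ 16 ∧ ∀ u, flipNoise L φ u = c * φ u := by
  have hinv : ∀ z : Fin L, ¬(z = x ∨ z = y) → ∀ u, φ (momentumFlip z u) = φ u := by
    intro z hz u
    refine hdep _ _ fun k hk => ⟨rfl, ?_⟩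
    rw [momentumFlip_snd_of_ne]
    rintro rfl
    exact hz hk
  by_cases hxy : x = y
  · subst hxy
    refine ⟨-2, by norm_num, fun u => ?_⟩
    rw [flipNoise_eq, Fintype.sum_eq_single x fun z hz => by rw [hinv z (by tauto), sub_self], hoddx]
    ring
  · refine ⟨-4, by norm_num, fun u => ?_⟩
    rw [flipNoise_eq, Fintype.sum_eq_add x y hxy fun z hz => by rw [hinv z (by tauto), sub_self], hoddx, hoddy]
    ring

end TwoSite

/-! ## The Liouville operator on observables with bounded partials -/

section Liouville

variable {ω₂ lam β : ℝ}

/-- **Linear energy bound for `X_H φ`**: if all first partials of `φ` are bounded by `M ≥ 0`, then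
`|X_H φ| ≤ M (L + C_L)(1 + H)` for the pinned chain (`ω₂ > 0`, `lam, β ≥ 0`), with `C_L` the constant of the
linear energy bound `Σ_i |∂_{q_i}H| ≤ C_L (1 + H)` (`pinnedChain_sum_abs_partialQ_le`) and `|p_i| ≤ 1 + H`.
[folklore] -/
theorem pairRadiation_abs_liouvilleOp_le (hω : 0 < ω₂) (hl : 0 ≤ lam) (hβ : 0 ≤ β) (γ : ℝ) {L : ℕ}
    {φ : PhaseSpace L → ℝ} {M : ℝ} (hM0 : 0 ≤ M)
    (hM : ∀ (i : Fin L) (u : PhaseSpace L), |partialQ i φ u| ≤ M ∧ |partialP i φ u| ≤ M) (u : PhaseSpace L) :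
    |liouvilleOp (pinnedChain ω₂ lam β γ) L φ u| ≤
      M * (L + L * (ω₂ / 2 + 3 + lam / ω₂ + L ^ 2 * (3 + β))) * (1 + (pinnedChain ω₂ lam β γ).hamiltonian L u) := by
  set P := pinnedChain ω₂ lam β γ with hP
  set H := P.hamiltonian L u with hH
  have hH0 : 0 ≤ H := pinnedChain_hamiltonian_nonneg hω.le hl hβ γ L u
  -- `|p_i| ≤ 1 + H`, summed, and the linear energy bound
  have hsumP : ∑ i : Fin L, |u.2 i| ≤ L * (1 + H) := by
    have hp : ∀ i : Fin L, |u.2 i| ≤ 1 + H := fun i => by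
      have h2 : u.2 i ^ 2 ≤ 2 * H := pinnedChain_sq_le_two_mul_hamiltonian hω.le hl hβ γ L u i
      nlinarith [sq_abs (u.2 i), sq_nonneg (|u.2 i| - 1), abs_nonneg (u.2 i)]
    calc ∑ i : Fin L, |u.2 i| ≤ ∑ _i : Fin L, (1 + H) := Finset.sum_le_sum fun i _ => hp i
      _ = L * (1 + H) := by rw [Finset.sum_const, Finset.card_univ, Fintype.card_fin, nsmul_eq_mul]
  have hsumQ := pinnedChain_sum_abs_partialQ_le hω hl hβ γ L u
  -- termwise
  have hterm : ∀ i : Fin L, |u.2 i * partialQ i φ u - partialQ i (P.hamiltonian L) u * partialP i φ u| ≤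
      M * |u.2 i| + M * |partialQ i (P.hamiltonian L) u| := by
    intro i
    have h1 := mul_le_mul_of_nonneg_left (hM i u).1 (abs_nonneg (u.2 i))
    have h2 := mul_le_mul_of_nonneg_left (hM i u).2 (abs_nonneg (partialQ i (P.hamiltonian L) u))
    refine (abs_sub _ _).trans ?_
    rw [abs_mul, abs_mul]
    linarith
  have hsum := (Finset.abs_sum_le_sum_abs _ _).trans (Finset.sum_le_sum fun i (_ : i ∈ Finset.univ) => hterm i)
  rw [Finset.sum_add_distrib, ← Finset.mul_sum, ← Finset.mul_sum] at hsum
  unfold liouvilleOp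
  refine hsum.trans ?_
  have h3 := mul_le_mul_of_nonneg_left hsumP hM0
  have h4 := mul_le_mul_of_nonneg_left hsumQ hM0
  nlinarith [h3, h4]

end Liouville

/-! ## The registered stub -/

section Stub

variable {ω₂ lam β γ : ℝ}

/-- **Stub S3 · forwardFieldPairRadiation** (line `line-energy_dipole_leak_coercivity`, crux
stmt-AtomisticToContinuum-11976). For the pinned chain (all parameters `> 0`), `T > 0`, any `ε`, `L ≥ 2`, a
classical `C²` forward field `g` of the flip-noisy equilibrium generator with `|g| ≤ C₀e^{H/4T}` and
`(L_{T,T} + εS) g = −(p_0² − T)`, interior sites `x, y` (`1 ≤ x, y ≤ L − 2`) and every smooth `φ` depending only on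
the coordinates of `x, y`, vanishing as soon as one of them is `≥ R` in absolute value, odd in `p_x` and in `p_y`:
`(∫ g X_H φ dμ_T)² ≤ 2ε² (‖g∘F_x − g‖² + ‖g∘F_y − g‖²) ‖φ‖²` in `L²(μ_T)` — the pair radiation of the forward
field is `O(ε × local flip mass)`: `∫ g X_H φ = εc ∫ gφ` with `c² ≤ 16` (cross Green identity against the backward
pair `(φ, X_H φ)`, oddness, `Sφ = cφ`), and `(∫ gφ)² ≤ ¼‖g∘F_z − g‖²‖φ‖²` for `z = x, y` by oddness.
[cite: BernardinOlla2011, §2.1] -/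
theorem stub_forwardFieldPairRadiation :
    ∀ ω₂ lam β γ : ℝ, 0 < ω₂ → 0 < lam → 0 < β → 0 < γ → ∀ (T ε : ℝ), 0 < T →
      ∀ (L : ℕ), 2 ≤ L → ∀ g : PhaseSpace L → ℝ, ContDiff ℝ 2 g →
        (∃ C₀ : ℝ, ∀ u, |g u| ≤ C₀ * Real.exp (1 / (4 * T) * (pinnedChain ω₂ lam β γ).hamiltonian L u)) →
        (∀ u, (pinnedChain ω₂ lam β γ).flipGenerator L T T ε g u = -(kin L 0 u - T)) →
        ∀ x y : Fin L, 1 ≤ x.val → x.val + 2 ≤ L → 1 ≤ y.val → y.val + 2 ≤ L →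
        ∀ φ : PhaseSpace L → ℝ, ContDiff ℝ ((⊤ : ℕ∞) : WithTop ℕ∞) φ →
          (∀ u v : PhaseSpace L,
            (∀ k : Fin L, (k = x ∨ k = y) → u.1 k = v.1 k ∧ u.2 k = v.2 k) → φ u = φ v) →
          (∃ R : ℝ, ∀ u : PhaseSpace L,
            (R ≤ |u.1 x| ∨ R ≤ |u.2 x| ∨ R ≤ |u.1 y| ∨ R ≤ |u.2 y|) → φ u = 0) →
          (∀ u, φ (momentumFlip x u) = -φ u) → (∀ u, φ (momentumFlip y u) = -φ u) →
          (∫ u, g u * liouvilleOp (pinnedChain ω₂ lam β γ) L φ u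
              ∂((pinnedChain ω₂ lam β γ).gibbsMeasure L T)) ^ 2 ≤
            2 * ε ^ 2 *
              ((∫ u, (g (momentumFlip x u) - g u) ^ 2 ∂((pinnedChain ω₂ lam β γ).gibbsMeasure L T)) +
                ∫ u, (g (momentumFlip y u) - g u) ^ 2 ∂((pinnedChain ω₂ lam β γ).gibbsMeasure L T)) *
              ∫ u, φ u ^ 2 ∂((pinnedChain ω₂ lam β γ).gibbsMeasure L T) := by
  intro ω₂ lam β γ hω hl hβ hγ T ε hT L hL g hg2 hgb hpde x y hx1 hx2 hy1 hy2 φ hφ hdep hR hoddx hoddy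
  obtain ⟨C₀, hC₀⟩ := hgb
  obtain ⟨R, hR⟩ := hR
  have hL0 : 0 < L := by omega
  set P := pinnedChain ω₂ lam β γ with hP
  set μ := P.gibbsMeasure L T with hμdef
  set Bw := OscillatorChain.bathWeight L with hBw
  haveI : IsProbabilityMeasure μ := pinnedChain_isProbabilityMeasure_gibbsMeasure hω hl.le hβ.le γ L hT
  have hflip := gibbs_flipInvariant (ω₂ := ω₂) (lam := lam) (β := β) (γ := γ) L T
  -- `g ∈ L²(μ_T)` from the `e^{H/4T}` bound
  have h14' : 2 * (1 / (4 * T)) < 1 / T := by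
    rw [show 2 * (1 / (4 * T)) = 1 / (2 * T) by field_simp; ring, div_lt_div_iff₀ (by positivity) hT]
    nlinarith
  have hgL : MemLp g 2 μ := memLp_two_of_abs_le_exp hω hl.le hβ.le γ L hT h14' hg2.continuous hC₀
  -- regularity of `φ`: bounded, bounded partials, `φ, X_H φ ∈ L²(μ_T)`
  have hφ2 : ContDiff ℝ 2 φ := hφ.of_le (by norm_cast)
  have hφ1 : ContDiff ℝ 1 φ := hφ.of_le (by norm_cast)
  obtain ⟨Mφ, hMφ⟩ := pairRadiation_exists_bound hφ.continuous hdep hR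
  obtain ⟨M, hM0, hM⟩ := pairRadiation_exists_partial_bound hφ1 hdep hR
  have hφL2 : MemLp φ 2 μ :=
    pinnedChain_memLp_two_of_abs_le hω hl.le hβ.le γ L hT hφ.continuous (C := Mφ) (k := 0) fun u => by
      rw [pow_zero, mul_one]; exact hMφ u
  -- the thermostats do not see `φ`: `S_B φ = 0`, so `(φ, X_H φ)` is a backward pair
  have hbath : ∀ u, bathOp L Bw T φ u = 0 := by
    intro u
    unfold bathOp
    refine Finset.sum_eq_zero fun i _ => ?_
    by_cases hi : i = x ∨ i = y
    · have h1 : i.val ≠ 0 := by rcases hi with rfl | rfl <;> omega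
      have h2 : i.val ≠ L - 1 := by rcases hi with rfl | rfl <;> omega
      have hBi : Bw i = 0 := by simp [hBw, OscillatorChain.bathWeight, h1, h2]
      rw [hBi, zero_mul]
    · have hP0 : partialP i φ = fun _ => 0 := funext fun v => pairRadiation_partialP_eq_zero hdep hi v
      have hPP0 : partialP i (partialP i φ) u = 0 := by
        rw [hP0]
        unfold partialP
        exact deriv_const _ _
      rw [hPP0, hP0]
      ring
  have hpφ : ∀ u, -1 * liouvilleOp P L φ u + γ * bathOp L Bw T φ u = -(liouvilleOp P L φ u) := by
    intro u; rw [hbath u]; ring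
  have hXc : Continuous (liouvilleOp P L φ) := continuous_source Bw T (-1) γ hφ2 hpφ
  have hXL2 : MemLp (liouvilleOp P L φ) 2 μ :=
    pinnedChain_memLp_two_of_abs_le hω hl.le hβ.le γ L hT hXc (k := 1) fun u => by
      rw [pow_one]; exact pairRadiation_abs_liouvilleOp_le hω hl.le hβ.le γ hM0 hM u
  -- the forward pair `(g, (p_0² − T) + εSg)`
  have hk0L2 : MemLp (fun u => kin L 0 u - T) 2 μ :=
    ((pinnedChain_memLp_two_snd_sq hω hl.le hβ.le γ L hT ⟨0, hL0⟩).sub (memLp_const T)).ae_eq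
      (ae_of_all _ fun u => by simp [kin_eq_sq hL0])
  have hSgL2 : MemLp (flipNoise L g) 2 μ := memLp_flipNoise hflip hgL
  set k' : PhaseSpace L → ℝ := fun u => (kin L 0 u - T) + ε * flipNoise L g u with hk'
  have hk'L2 : MemLp k' 2 μ := hk0L2.add (hSgL2.const_mul ε)
  have hB0 : ∀ i, 0 ≤ Bw i := fun i => by
    simp only [hBw, OscillatorChain.bathWeight]
    positivity
  have hpg : ∀ u, 1 * liouvilleOp P L g u + γ * bathOp L Bw T g u = -k' u := fun u =>
    flip_forwardPair (ω₂ := ω₂) (lam := lam) (β := β) (γ := γ) L T ε (k := fun w => kin L 0 w - T) hpde u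
  -- the cross Green identity, cutoff removed, in Gibbs-measure form
  have hρeq : ∫ u, φ u * k' u * P.gibbsDensity L T u = ∫ u, g u * liouvilleOp P L φ u * P.gibbsDensity L T u :=
    integral_cross_eq hω hl.le hβ.le L hT Bw hB0 1 hγ hg2 hφ2 hgL hk'L2 hφL2 hXL2 hpg hpφ
  have hμeq : ∫ u, g u * liouvilleOp P L φ u ∂μ = ∫ u, φ u * k' u ∂μ := by
    rw [P.integral_gibbsMeasure, P.integral_gibbsMeasure, hρeq]
  -- `∫ φ (p_0² − T) dμ = 0`: `φ` is odd and `p_0² − T` even under `F_x`, `μ_T` is `F_x`-invariant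
  have hkinflip : ∀ u, kin L 0 (momentumFlip x u) = kin L 0 u := by
    intro u
    rw [kin_eq_sq hL0, kin_eq_sq hL0]
    by_cases h0 : (⟨0, hL0⟩ : Fin L) = x
    · rw [h0, momentumFlip_snd_self]; ring
    · rw [momentumFlip_snd_of_ne h0]
  have hφk0 : ∫ u, φ u * (kin L 0 u - T) ∂μ = 0 := by
    have h1 : ∫ u, φ (momentumFlip x u) * (kin L 0 (momentumFlip x u) - T) ∂μ =
        ∫ u, φ u * (kin L 0 u - T) ∂μ :=
      integral_comp_momentumFlip (hflip x) (fun u => φ u * (kin L 0 u - T))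
    have h2 : ∫ u, φ (momentumFlip x u) * (kin L 0 (momentumFlip x u) - T) ∂μ =
        -∫ u, φ u * (kin L 0 u - T) ∂μ := by
      rw [← integral_neg]
      refine integral_congr_ae (ae_of_all _ fun u => ?_)
      dsimp only
      rw [hoddx u, hkinflip u]
      ring
    linarith
  -- `∫ φ Sg dμ = ∫ (Sφ) g dμ = c ∫ g φ dμ`
  obtain ⟨c, hc16, hSφ⟩ := pairRadiation_flipNoise_eq hdep hoddx hoddy
  have hφSg : ∫ u, φ u * flipNoise L g u ∂μ = c * ∫ u, g u * φ u ∂μ := by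
    have hgi : ∀ i, MemLp (fun u => g (momentumFlip i u)) 2 μ := memLp_comp_momentumFlip hflip hgL
    rw [integral_mul_flipNoise hflip (hφL2.integrable_mul hgL) (fun i => hφL2.integrable_mul (hgi i)),
      ← integral_const_mul]
    refine integral_congr_ae (ae_of_all _ fun u => ?_)
    dsimp only
    rw [hSφ u]
    ring
  -- hence `∫ g X_H φ dμ = ε c ∫ g φ dμ`
  have hmain : ∫ u, g u * liouvilleOp P L φ u ∂μ = ε * c * ∫ u, g u * φ u ∂μ := by
    rw [hμeq]
    have i1 : Integrable (fun u => φ u * (kin L 0 u - T)) μ := hφL2.integrable_mul hk0L2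
    have i2 : Integrable (fun u => φ u * flipNoise L g u) μ := hφL2.integrable_mul hSgL2
    have e : (fun u => φ u * k' u) = fun u => φ u * (kin L 0 u - T) + ε * (φ u * flipNoise L g u) := by
      funext u; simp only [hk']; ring
    rw [e, integral_add i1 (i2.const_mul ε), integral_const_mul, hφk0, hφSg]
    ring
  -- one-flip Cauchy–Schwarz at `x` and at `y`, and the arithmetic `c² ≤ 16`
  have hcx := sq_integral_mul_le_of_odd (hflip x) hgL hφL2 hoddx
  have hcy := sq_integral_mul_le_of_odd (hflip y) hgL hφL2 hoddy
  rw [hmain]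
  set I := ∫ u, g u * φ u ∂μ with hI
  set dx := ∫ u, (g (momentumFlip x u) - g u) ^ 2 ∂μ with hdx
  set dy := ∫ u, (g (momentumFlip y u) - g u) ^ 2 ∂μ with hdy
  set Φ := ∫ u, φ u ^ 2 ∂μ with hΦ
  have hε2 : 0 ≤ ε ^ 2 := sq_nonneg ε
  have hI2 : 0 ≤ I ^ 2 := sq_nonneg I
  calc (ε * c * I) ^ 2 = ε ^ 2 * c ^ 2 * I ^ 2 := by ring
    _ ≤ ε ^ 2 * 16 * I ^ 2 := by gcongr
    _ = 8 * ε ^ 2 * I ^ 2 + 8 * ε ^ 2 * I ^ 2 := by ring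
    _ ≤ 8 * ε ^ 2 * (1 / 4 * dx * Φ) + 8 * ε ^ 2 * (1 / 4 * dy * Φ) := by gcongr
    _ = 2 * ε ^ 2 * (dx + dy) * Φ := by ring

end Stub

end Summit.AtomisticToContinuum.FouriersLaw.Theorems.VanishingNoiseBound

end
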